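import Summits.BirchSwinnertonDyer.BirchSwinnertonDyer.Theorems.KatoDescentPotSupersingularMemberHullNondegenerate
import Summits.BirchSwinnertonDyer.BirchSwinnertonDyer.Theorems.KatoDescentPotSupersingularMemberHullRankOne
import Summits.BirchSwinnertonDyer.BirchSwinnertonDyer.Theorems.KatoDescentPotSupersingularReducibleKatoMemberOfZetaInputsNodes
import Literature.NumberTheory.EllipticCurves.Kato2004.MemberHullValueInputs
import Literature.NumberTheory.EllipticCurves.Kato2004.IwasawaH1RankLeOneProofs
import Literature.NumberTheory.EllipticCurves.IwasawaAlgebraRankOneIdealProofs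
import Summits.BirchSwinnertonDyer.Rank1Residual.O5.O5Targets
import HarnessLib

/-!
# Cell `bsd-potss`, routes K9 / K8-t′: the node `O6.KatoMemberShaBoundOfReducible` (= the SHARED crux M
# `ReducibleKatoMember`, item stmt-BirchSwinnertonDyer-19196) FROM THE VALUE-GUARDED INPUTS AT KATO'S MEMBER —
# ROUTE-FREE kernel module: `exists_memberHullValueInputs → rank_eq_analyticRank_of_analyticRank_le_one →
# exists_memberHullZetaInputs`, hence `exists_isNewformOf → exists_memberHullValueInputs → GZK → crux M`

Seat `bsd-potss-rkm` generation 10.  `Kato2004.exists_memberHullValueInputs` (file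
`Kato2004/MemberHullValueInputs.lean`, this seat) is the VALUE-GUARDED re-type of the held input of crux M: the
structure `MemberHullValueInputs` drops the clauses `z_ne_zero` (Thm. 12.5 (1)), `isTorsion_quotient`
(Thm. 12.5 (2)), `lam_constantCoeff_ne_zero` (Lemma 13.10 (1)) and `index_ne_zero` (Thm. 14.5 (2)) of
`MemberHullZetaInputs`, and the fact's witness clause displays Kato's admissible choice
`(cd, A) = 1 ∧ ∃ d′, dd′ ≡ 1 (A) ∧ cuspFactor f true 1 c d a A d′ ≠ 0`.  This module RESTORES the four clauses
on every pin of the member from the tree's theorems — `MemberIndexOfValue.not_isOfFinAddOrder_proj_zero_of_zetaBody`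
+ `IwasawaH2Data.natCard_quotient_span_ne_zero_of_zetaBody` (p525403: the value law at the bottom level makes
`proj₀ 𝐲` non-torsion when `L(W,1) ≠ 0`; (R0) + rank bookkeeping), `MemberHullRankOne.isTorsion_hull_quotient`
(p526067: (R2) + (R0)), `MemberHullNondegenerate.{ne_zero,constantCoeff_ne_zero}_of_hull_smul` (p526771) —
with `W_K(ℚ)` and `Ш(W_K)[p^∞]` finite from `L(W,1) ≠ 0`, GZK and the isogeny exactly as in the typer's
`exists_memberHullInputs_of_zetaInputs`:
* `nonempty_memberHullZetaInputs_of_value` — one pin: value package + `ZetaBody` + guards ⟹ zeta package;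
  `rank_iwasawaH1_eq_one_of_zetaBody` (Thm. 12.4 (2) in full on such a pin: `rank_Λ 𝐇¹_Γ = 1`) and
  `exists_linearEquiv_ideal_finite_quotient_of_zetaBody` (13.14 as a theorem: `𝐇¹_Γ ≃ 𝔟 ≤ Λ` of finite index
  — the hull can be taken to be `Λ`);
* **`exists_memberHullZetaInputs_of_valueInputs : exists_memberHullValueInputs →
  rank_eq_analyticRank_of_analyticRank_le_one → exists_memberHullZetaInputs`**;
* `exists_memberHullInputs_of_valueInputs` (→ the original held input 19659, via rkm g10's
  `ReducibleOfZetaInputs.exists_memberHullInputs_of_zetaInputs_of_GZK`);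
* **`katoMemberShaBoundOfReducible_of_memberHullValueInputs : exists_isNewformOf →
  exists_memberHullValueInputs → rank_eq_analyticRank_of_analyticRank_le_one → O6.KatoMemberShaBoundOfReducible`**
  (+ 4-ary form in the resplit order and `_and` form).
CONDITIONAL (audit `proof.conditional`) on the named facts; no item is closed here; the route-typed one-line
closers are the sibling files `KatoDescent{,Tame}PotSupersingularReducibleKatoMemberOfValueInputs.lean`.
HONEST FRAMING: BSD is not advanced; nothing is booked; the trust base of M becomes {modularity, GZK, the
value-guarded transcription of Kato Thm. 12.5 (3)/12.6/13.10 (1)/13.14/14.16 (2) + Wuthrich L.14 at the member}.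

References: [Kato2004Asterisque] Thm. 12.5–12.6 (pp. 221–222), Lemma 13.10 (1) (p. 230), 13.14 (p. 234),
Thm. 14.5 (p. 236), §14.14 (p. 243), Prop. 14.16 (2) (p. 244), Thm. 9.7 (p. 189), Thm. 6.6 (1) (p. 163);
[Wuthrich2014] Lemma 14; [Darmon2004] Thm. 3.22; [DiamondShurman2005] Thm. 8.8.3.
-/

set_option autoImplicit false
set_option linter.dupNamespace false

noncomputable section

open scoped NumberField TensorProduct
open Field IsDedekindDomain CongruenceSubgroup Function
open Literature.NumberTheory.GaloisRepresentations
open Literature.NumberTheory.EllipticCurves Literature.NumberTheory.EllipticCurves.ModularForms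
open Literature.NumberTheory.EllipticCurves.Kato2004
open Literature.NumberTheory.EllipticCurves.Kato2004.EulerSystemValues Rat.HeightOneSpectrum
open Literature.NumberTheory.EllipticCurves.IwasawaAlgebra

namespace Summit.BirchSwinnertonDyer.BirchSwinnertonDyer.Theorems.ReducibleOfValueInputs

/-! ## One pin: the four dropped clauses restored -/

section Pin

variable {W : WeierstrassCurve ℚ} [W.IsElliptic] {p : ℕ} [Fact p.Prime]
  [ContinuousSMul ℤ_[p] (W.tateModule p)] [Module.Free ℤ_[p] (W.tateModule p)]
  [Module.Finite ℤ_[p] (W.tateModule p)] {N : ℕ} [NeZero N] {f : CuspForm (Gamma0 N) 2}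
  {ι : (m : ℕ) → (CyclotomicField m ℚ →+* ℂ)} {κ' : ℝ}
  {Λ : ∀ (k : ℕ) (r : Finset (HeightOneSpectrum (𝓞 ℚ))),
    H1 (tateRep W p) (cycSubgroup p k r) →ₗ[ℤ_[p]] ℚ_[p] ⊗[ℚ] CyclotomicField (cycLevel p k r) ℚ}
  {c d a : ℤ} {A : ℕ}
  {z : ∀ (k : ℕ) (r : (cyclotomicLevelsRat p (badPlaces c d A N)).Ideals),
    H1 (tateRep W p) ((cyclotomicLevelsRat p (badPlaces c d A N)).level k r.1)}
  {x : ∀ (k : ℕ) (r : (cyclotomicLevelsRat p (badPlaces c d A N)).Ideals),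
    CyclotomicField (cycLevel p k r.1) ℚ}
  {V : WeierstrassCurve ℚ} [V.IsElliptic]
  {κ : ZpExtension ℚ p} {γ : absoluteGaloisGroup ℚ} {I : IwasawaH1Data W p κ γ} {y : I.H}

/-- **One pin: a value package over the lift of a guarded `ZetaBody` witness YIELDS a zeta package** (`κ`
cyclotomic, `γ` a topological generator, `p` odd, `W(ℚ)` and `Ш(W)[p^∞]` finite; `κ′ ≠ 0`, `f` the newform of a
curve `V` with `L(V,1) ≠ 0`, `(cd, A) = 1`, `dd′ ≡ 1 (A)`, `cuspFactor f true 1 c d a A d′ ≠ 0`): the clauses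
`z_ne_zero`, `isTorsion_quotient`, `lam_constantCoeff_ne_zero`, `index_ne_zero` are supplied by the tree
theorems of the module docstring (stated as `Nonempty`, the shape the facts quantify).
[cite: Kato2004Asterisque, Thm. 12.5 (1)(2) (pp. 221–222), Lemma 13.10 (1) (p. 230), Thm. 14.5 (2) (p. 236)] -/
theorem nonempty_memberHullZetaInputs_of_value (P : MemberHullValueInputs W p κ γ I y)
    [Finite W.toAffine.Point] [Finite (AddCommGroup.primaryComponent W.sha p)]
    (hκ : κ.IsCyclotomic) (hγ : κ.IsTopGenerator γ) (hp : p ≠ 2)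
    (hbody : ZetaBody W p f ι κ' Λ c d a A z x) (hκ' : κ' ≠ 0)
    (hf : IsNewformOf V f) (hL1 : V.entireLFunction 1 ≠ 0) (hA : 0 < A) (d' : ℤ)
    (hcd : Int.gcd (c * d) A = 1) (hdd' : d * d' ≡ 1 [ZMOD (A : ℤ)])
    (hR : cuspFactor f true (fun _ ↦ 1) c d a A d' ≠ 0)
    (hy : ∀ n : ℕ, I.proj n y = levelToLayer W p hκ hp (badPlaces c d A N) n
      (z (n + 1) (cyclotomicLevelsRat p (badPlaces c d A N)).idealOne)) :
    Nonempty (MemberHullZetaInputs W p κ γ I y) := by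
  haveI := P.torsionFree_F
  haveI := P.finite_F
  have hnt : ¬ IsOfFinAddOrder (I.proj 0 y) :=
    MemberIndexOfValue.not_isOfFinAddOrder_proj_zero_of_zetaBody hκ hp hbody hκ' hf hL1 hA d' hcd hdd' hR hy
  have hz : P.z ≠ 0 := MemberHullNondegenerate.ne_zero_of_hull_smul I P.j P.j_injective P.j_y hnt
  exact ⟨P.toMemberHullZetaInputs hz
    (MemberHullRankOne.isTorsion_hull_quotient hκ hγ I P.j P.j_injective P.finite_coker hz)
    (MemberHullNondegenerate.constantCoeff_ne_zero_of_hull_smul I P.j P.j_injective P.finite_coker P.j_y hnt)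
    (MemberIndexOfValue.IwasawaH2Data.natCard_quotient_span_ne_zero_of_zetaBody (P.toIwasawaH2Data hκ hγ)
      hκ hp hbody hκ' hf hL1 hA d' hcd hdd' hR hy)⟩

/-- **Kato Thm. 12.4 (2) IN FULL on such a pin: `rank_Λ 𝐇¹_Γ(T_pW) = 1`** (`W(ℚ)`, `Ш(W)[p^∞]` finite):
`𝐇¹_Γ ≠ 0` because `proj₀ 𝐲` is not torsion (the value), `≤ 1` by (R2) + (R0)
(`IwasawaH1Data.rank_eq_one_of_rank_integralH1_le_one`).  The lower half «`𝐇¹_Γ ≠ 0`» (named fact (NT) /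
`Kato2004.one_le_rank_iwasawaH1` elsewhere in the tree) is thus DISCHARGED on every row carrying a guarded
`ZetaBody` witness. [cite: Kato2004Asterisque, Thm. 12.4 (2) (p. 221), Thm. 14.5 (1)(2) (p. 236)] -/
theorem rank_iwasawaH1_eq_one_of_zetaBody
    [Finite W.toAffine.Point] [Finite (AddCommGroup.primaryComponent W.sha p)]
    (hκ : κ.IsCyclotomic) (hγ : κ.IsTopGenerator γ) (hp : p ≠ 2)
    (hbody : ZetaBody W p f ι κ' Λ c d a A z x) (hκ' : κ' ≠ 0)
    (hf : IsNewformOf V f) (hL1 : V.entireLFunction 1 ≠ 0) (hA : 0 < A) (d' : ℤ)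
    (hcd : Int.gcd (c * d) A = 1) (hdd' : d * d' ≡ 1 [ZMOD (A : ℤ)])
    (hR : cuspFactor f true (fun _ ↦ 1) c d a A d' ≠ 0)
    (hy : ∀ n : ℕ, I.proj n y = levelToLayer W p hκ hp (badPlaces c d A N) n
      (z (n + 1) (cyclotomicLevelsRat p (badPlaces c d A N)).idealOne)) :
    Module.rank (IwasawaAlgebra p) I.H = 1 := by
  haveI : Nontrivial I.H := nontrivial_of_ne y 0
    (MemberHullNondegenerate.ne_zero_of_not_isOfFinAddOrder_proj_zero I
      (MemberIndexOfValue.not_isOfFinAddOrder_proj_zero_of_zetaBody hκ hp hbody hκ' hf hL1 hA d' hcd hdd'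
        hR hy))
  exact I.rank_eq_one_of_rank_integralH1_le_one hκ hγ
    (IntegralH1RankZero.rank_integralH1_layerZero_le_one W p κ)

/-- **Kato 13.14 / Wuthrich Lemma 12 AS A THEOREM on such a pin: the reflexive hull of `𝐇¹_Γ(T_pW)` is FREE OF
RANK ONE with finite cokernel** — `𝐇¹_Γ ≃ₗ[Λ] 𝔟` for an ideal `𝔟 ≠ 0` of `Λ` with `Λ ⧸ 𝔟` finite (the tree's
`IwasawaAlgebra.exists_linearEquiv_ideal_finite_quotient`, Bourbaki AC VII §4 no. 2, applied with rank `1` from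
`rank_iwasawaH1_eq_one_of_zetaBody`, (12.2.1) `module_finite_of_isCyclotomic` and torsion-freeness).  So the hull
fields `(F, j, finite_coker)` of the package can be realised with `F = Λ` on every row.
[cite: Kato2004Asterisque, 13.14 (p. 234)] [cite: Wuthrich2014, Lemma 12 (p. 395)] [cite: BourbakiAC5to7, Ch. VII §4 no. 2] -/
theorem exists_linearEquiv_ideal_finite_quotient_of_zetaBody
    [Finite W.toAffine.Point] [Finite (AddCommGroup.primaryComponent W.sha p)]
    (hκ : κ.IsCyclotomic) (hγ : κ.IsTopGenerator γ) (hp : p ≠ 2)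
    (hbody : ZetaBody W p f ι κ' Λ c d a A z x) (hκ' : κ' ≠ 0)
    (hf : IsNewformOf V f) (hL1 : V.entireLFunction 1 ≠ 0) (hA : 0 < A) (d' : ℤ)
    (hcd : Int.gcd (c * d) A = 1) (hdd' : d * d' ≡ 1 [ZMOD (A : ℤ)])
    (hR : cuspFactor f true (fun _ ↦ 1) c d a A d' ≠ 0)
    (hy : ∀ n : ℕ, I.proj n y = levelToLayer W p hκ hp (badPlaces c d A N) n
      (z (n + 1) (cyclotomicLevelsRat p (badPlaces c d A N)).idealOne)) :
    ∃ 𝔟 : Ideal (IwasawaAlgebra p), Finite (IwasawaAlgebra p ⧸ 𝔟) ∧ 𝔟 ≠ ⊥ ∧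
      Nonempty (I.H ≃ₗ[IwasawaAlgebra p] 𝔟) := by
  haveI := IwasawaH1Data.module_finite_of_isCyclotomic hκ hγ I
  haveI := I.isTorsionFree hγ
  exact IwasawaAlgebra.exists_linearEquiv_ideal_finite_quotient
    (rank_iwasawaH1_eq_one_of_zetaBody hκ hγ hp hbody hκ' hf hL1 hA d' hcd hdd' hR hy)

end Pin

/-! ## The kernel theorem between the facts, and the node -/

/-- **KERNEL: the zeta-only fact from the value-guarded fact** —
`exists_memberHullValueInputs → rank_eq_analyticRank_of_analyticRank_le_one → exists_memberHullZetaInputs`.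
On each pin of the member `W_K`: `W_K(ℚ)` finite (analytic rank `0`, GZK at `W`, `mordellWeilRank_eq_zero_iff_finite`,
`finite_point_of_isIsogenous`), `Ш(W_K)` finite (`IsIsogenous.shaFinite_iff_shaFinite`), and
`nonempty_memberHullZetaInputs_of_value` with the displayed guard of the witness clause.
[cite: Kato2004Asterisque, Thm. 12.5 (1)(2) (pp. 221–222), Lemma 13.10 (1) (p. 230), Thm. 14.5 (1)(2) (p. 236), §14.14 (14.14.1) (p. 243)]
[cite: Darmon2004, Thm. 3.22] -/
theorem exists_memberHullZetaInputs_of_valueInputs (hV : Kato2004.exists_memberHullValueInputs)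
    (hGZK : rank_eq_analyticRank_of_analyticRank_le_one) : Kato2004.exists_memberHullZetaInputs := by
  intro W _ _ p _ hp hgood hmult hj hirr hL hsha
  obtain ⟨W', hW'e, hW'm, hiso, hrest⟩ := hV W p hp hgood hmult hj hirr hL hsha
  haveI := hW'e
  have h0 : W.analyticRank = 0 :=
    Summit.BirchSwinnertonDyer.Rank1Residual.O5.analyticRank_eq_zero_of_entireLFunction_one_ne_zero W hL
  obtain ⟨hrk, -⟩ := hGZK W (by rw [h0]; exact zero_le_one)
  rw [h0] at hrk
  haveI hWfin : Finite W.toAffine.Point := (W.mordellWeilRank_eq_zero_iff_finite).mp hrk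
  haveI hW'fin : Finite W'.toAffine.Point := finite_point_of_isIsogenous hiso.symm_of_isElliptic hWfin
  have hshaW' : W'.ShaFinite := hiso.shaFinite_iff_shaFinite.mp hsha
  haveI : Finite W'.sha := hshaW'
  refine ⟨W', hW'e, hW'm, hiso, ?_⟩
  intro _ _ _ N _ f hf ι
  obtain ⟨κ', Λ', c, d, a, A, z, x, hκ', hA, hc, hd, hcd, ⟨d', hdd', hR⟩, hZB, hall⟩ := hrest f hf ι
  refine ⟨κ', Λ', c, d, a, A, z, x, hκ', hA, hc, hd, hZB, ?_⟩
  intro κ γ hκ hγ I y hy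
  obtain ⟨P⟩ := hall κ γ hκ hγ I y hy
  exact nonempty_memberHullZetaInputs_of_value P hκ hγ hp hZB hκ' hf hL hA d' hcd hdd' hR hy

/-- **The original held input (item 19659) from the value-guarded fact and GZK**:
`exists_memberHullValueInputs → rank_eq_analyticRank_of_analyticRank_le_one → exists_memberHullInputs`.
[cite: Kato2004Asterisque, Thm. 14.5 (1)(2) (p. 236) and §14.14 (14.14.1)–(14.14.2) (p. 243)] -/
theorem exists_memberHullInputs_of_valueInputs (hV : Kato2004.exists_memberHullValueInputs)
    (hGZK : rank_eq_analyticRank_of_analyticRank_le_one) : Kato2004.exists_memberHullInputs :=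
  ReducibleOfZetaInputs.exists_memberHullInputs_of_zetaInputs_of_GZK
    (exists_memberHullZetaInputs_of_valueInputs hV hGZK) hGZK

/-- **The node T-X3K = crux M from the value-guarded inputs**: `exists_isNewformOf →
exists_memberHullValueInputs → rank_eq_analyticRank_of_analyticRank_le_one → O6.KatoMemberShaBoundOfReducible`.
Conditional on the three named facts; nothing else assumed.
[cite: Kato2004Asterisque, Thm. 12.6 (p. 222), §14.14 and Lemma 14.15 (pp. 243–244), Prop. 14.16 (2) (p. 244)]
[cite: Wuthrich2014, Lemma 14 (p. 396)] [cite: Darmon2004, Thm. 3.22] -/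
theorem katoMemberShaBoundOfReducible_of_memberHullValueInputs (hmod : exists_isNewformOf)
    (hV : Kato2004.exists_memberHullValueInputs) (hGZK : rank_eq_analyticRank_of_analyticRank_le_one) :
    Summit.BirchSwinnertonDyer.Rank1Residual.O6.KatoMemberShaBoundOfReducible :=
  ReducibleOfZetaInputs.katoMemberShaBoundOfReducible_of_memberHullZetaInputs hmod
    (exists_memberHullZetaInputs_of_valueInputs hV hGZK) hGZK

/-- **Four-hypothesis form in the resplit order** (`PublishedInputIwasawaH1Data → PublishedInputNewformKato →
PublishedInputMemberHullValueInputs → PublishedInputRankEqAnalyticRank… → M`; the first hypothesis is a theorem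
and is not used). [cite: Kato2004Asterisque, Thm. 12.6 (p. 222), Prop. 14.16 (2) (p. 244)] -/
theorem katoMemberShaBoundOfReducible_of_valueInputs (_hne : Kato2004.nonempty_iwasawaH1Data)
    (hmod : exists_isNewformOf) (hV : Kato2004.exists_memberHullValueInputs)
    (hGZK : rank_eq_analyticRank_of_analyticRank_le_one) :
    Summit.BirchSwinnertonDyer.Rank1Residual.O6.KatoMemberShaBoundOfReducible :=
  katoMemberShaBoundOfReducible_of_memberHullValueInputs hmod hV hGZK

/-- **Conjunction form**. [cite: Kato2004Asterisque, Thm. 12.6 (p. 222), Prop. 14.16 (2) (p. 244)] -/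
theorem katoMemberShaBoundOfReducible_of_valueInputs_and
    (h : exists_isNewformOf ∧ Kato2004.exists_memberHullValueInputs ∧
      rank_eq_analyticRank_of_analyticRank_le_one) :
    Summit.BirchSwinnertonDyer.Rank1Residual.O6.KatoMemberShaBoundOfReducible :=
  katoMemberShaBoundOfReducible_of_memberHullValueInputs h.1 h.2.1 h.2.2

end Summit.BirchSwinnertonDyer.BirchSwinnertonDyer.Theorems.ReducibleOfValueInputs

end
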